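/-
Copyright: the b2b-balaban T⁴-continuum CRUX team, row NE7b OWNER lineage `t4-ne7b-p1` (gen 134). Project licence.
-/
import Summits.QuantumFields.BalabanUV.T4Continuum.Spine.NE7b.SupPolymerLocalStep
import Summits.QuantumFields.BalabanUV.T4Continuum.Spine.NE7b.SupPolymerLocalNextFactors

/-!
# THE ROAD'S STEP AS A MAP OF MAYER DATA — ONE STATEMENT: polymer-local Mayer data `(𝒳, f)` on the Gaussian road (singletons regulated, larger
# connected sets sup-small, measurable in their cells, local in the field) and an external field `ψ` small on the singleton members ⟹
#   `∫∏_{X∈𝒳}(1 + f_X(ω+ψ))dN(0,Γ)(ω) = ∏_{Y ∈ 𝒫(⋃𝒳)} (1 + f⁺_Y(ψ))`,   `f⁺_Y(ψ) := e^{K⁺_Y(ψ)} − 1`,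
# with the NEXT Mayer factors `f⁺_Y` indexed by the CONNECTED cell sets of the support, LOCAL in `ψ` (they see `ψ` only on the cells of `Y`), and
# of small pinned Kotecký–Preiss norm `Σ_{Y touching {q}}‖f⁺_Y(ψ)‖e^{τ₂#Y} ≤ 2(Δ+1)²·2ε′e^{1+τ₂}` (`ε′ = √ε″e^{2√ε″}`, `ε″ = ε_Ψ A_τ^v`) — (355) ∘ (358) ∘
# (361) in one place: «W ↦ W⁺» on the scalar road IS «Mayer data ↦ Mayer data», same sites (row NE7b, node U5c; BY NAME; [folklore])

Cell `pub-balaban`, sub-cell `t4`, spine estimate NE7b (`T4WeightBudget.RelWeightBound`; the cell's OWN estimate — NOT PRINTED in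
[Bałaban 1983–89], NOT PROVED).  Crux-route work under `Spine/NE7b/` by the row OWNER (`t4-ne7b-p1` gen 134, file (364)) under FREEZE
(0)'s crux-prover clause, on `g134/records/SCOPING-d6-iteration.md`; NOTHING of Bałaban's is named as a Lean object, valued or asserted; no
`T4Continuum/Support` leaf typed; no `def`, no notation; zero `sorry`.  Imports (BY NAME): the OWNER's (355) `…SupPolymerLocalStep` (`step_exp_sum_support`,
`step_supportTerm_local`, `shifted_pushforward_letters`), (361) `…SupPolymerLocalNextFactors` (`nextFactors_touchNorm_le`, `smallness_e_of_decay`), (358)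
(`exp_sum_eq_prod_one_add`).

WHAT IS PROVED ([folklore]; `z_ψ = ⋃_*M_ψ`, `K⁺_Y(ψ) = Σ_{𝒞 ⊆ L, ⋃𝒞=Y}Φ^T_ψ(𝒞)`, all displayed):
* **`road_step_mayer_product`** (`Z_ψ(𝒳) = ∏_{Y∈𝒫(⋃𝒳)}(1 + (e^{K⁺_Y(ψ)} − 1))`), **`road_step_nextFactor_local`** (`ψ = ψ'` on the cells of `Y` ⟹
  `e^{K⁺_Y(ψ)} − 1 = e^{K⁺_Y(ψ')} − 1`, no smallness), **`road_step_nextFactors_norm_le`** (the displayed pinned-norm bound under `0 ≤ τ₂`,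
  `(Δ+1)²ε′e^{1+τ₂} ≤ 1∕2`, `(Δ+1)·((Δ+1)·2ε′e^{1+τ₂}) ≤ 1`); toy.

HONEST (what this is NOT).  Composition only (no new estimate); fixed small `ψ` (the factors as FUNCTIONS of the next fluctuation field need (363)'s
small-field letter + the large-field excision, and the next activity letter needs the Gaussian integration of their products — SCOPING-d6 (L3)∕(L4));
weight shift and blocking are (356)∕(359)∕(360)∕(362); scalar skeleton ((A3), NC-NE7b-α UNRULED); nothing of Bałaban's asserted.  BY-NAME EFFECT ON THE
WALL: NONE.  NE7b NOT PRINTED ∕ NOT PROVED; spine PROVED 0∕9; rung (B)+1 — the programme's measures remain FINITE-torus statements; NOT the mass gap, NOT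
Clay.  HONEST DEPENDENCY: continuum YM on T⁴ ⇐ BetaPertH ∧ nine spine estimates (0∕9 proved); BetaPertH ⇐ (D1) ∧ (D4) ∧ CAP+tail; G-an2-4 gates
asym, D1 and NE2∕3∕4.
-/

set_option autoImplicit false

noncomputable section

namespace Summit.QuantumFields.BalabanUV.T4Continuum.NE7b.SupRoadStepMayerData

open MeasureTheory ProbabilityTheory Finset Real
open scoped BigOperators
open Literature.Probability.LatticeModels
open Literature.Analysis.Matrix (HasFiniteRange)
open SupPolymerLocalStep (step_exp_sum_support step_supportTerm_local shifted_pushforward_letters)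
open SupPolymerLocalNextFactors (nextFactors_touchNorm_le smallness_e_of_decay)
open SupStepReMayer (exp_sum_eq_prod_one_add)

variable {V : Type*} [DecidableEq V] {R : V → V → Prop} [DecidableRel R] {nbr : V → Finset V} {Δ : ℕ}
variable {ι : Type} [Fintype ι] [DecidableEq ι]

/-- **THE STEP AS A MAYER PRODUCT**: under the hypotheses of (355)'s `step_exp_sum_support`,
`Z_ψ(𝒳) = ∫∏_{X∈𝒳}(1 + f_X(ω+ψ))dN(0,Γ) = ∏_{Y ∈ 𝒫(⋃𝒳)}(1 + (e^{K⁺_Y(ψ)} − 1))`. [folklore] -/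
theorem road_step_mayer_product {Γ : Matrix ι ι ℝ} {γop γ : ℝ} (hΓ : Γ.PosSemidef) (hΓop : (γop • (1 : Matrix ι ι ℝ) - Γ).PosSemidef)
    (hdiag : ∀ i, Γ i i ≤ γ) (hγ : 0 ≤ γ) {dι : ι → ι → ℕ} {ρ : ℕ} (hfr : HasFiniteRange dι ρ Γ) (cell : V → Finset ι)
    (hdisj : ∀ p q, p ≠ q → Disjoint (cell p) (cell q)) {v : ℕ} (hv : ∀ p, (cell p).card ≤ v) (hRsymm : ∀ x y, R x y → R y x)
    (hR : ∀ (p p' : V) (x y : ι), x ∈ cell p → y ∈ cell p' → dι x y ≤ ρ → p = p' ∨ R p p')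
    (hΔ : ∀ x, (nbr x).card ≤ Δ) (hnbr : ∀ x y, R x y → y ∈ nbr x)
    {f : Finset V → EuclideanSpace ℝ ι → ℂ} {ε κ τ θ Ψ : ℝ} (hε : 0 ≤ ε) (hκ : 0 ≤ κ) (hτ : 0 < τ) (hθ0 : 0 < θ) (hθ1 : θ < 1)
    (hκθ : κ * (1 + τ) * γop ≤ θ) (𝒳 : Finset (Finset V)) (hconn : ∀ X ∈ 𝒳, IsRConnected R X)
    (hmeas : ∀ X ∈ 𝒳, Measurable[⨆ p ∈ X, MeasurableSpace.comap (fun (ω : EuclideanSpace ℝ ι) (x : cell p) => ω x) inferInstance] (f X))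
    (hreg : ∀ X ∈ 𝒳, X.card = 1 → ∀ ω : EuclideanSpace ℝ ι, ‖f X ω‖ ≤ ε ^ X.card * exp (κ * (∑ x ∈ X.biUnion cell, ω x ^ 2) / 2))
    (hsup : ∀ X ∈ 𝒳, X.card ≠ 1 → ∀ ω : EuclideanSpace ℝ ι, ‖f X ω‖ ≤ ε ^ X.card) (ψ : EuclideanSpace ℝ ι)
    (hψ : ∀ X ∈ 𝒳, X.card = 1 → ∑ x ∈ X.biUnion cell, ψ x ^ 2 ≤ Ψ ^ 2)
    (hsmall : Real.exp 1 * (Real.sqrt ((ε * exp (κ * (1 + τ⁻¹) * Ψ ^ 2 / 2)) * ((1 - θ) ^ (-(κ * (1 + τ) * γ / (2 * θ)))) ^ v) *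
      Real.exp (2 * Real.sqrt ((ε * exp (κ * (1 + τ⁻¹) * Ψ ^ 2 / 2)) * ((1 - θ) ^ (-(κ * (1 + τ) * γ / (2 * θ)))) ^ v))) *
      ((Δ : ℝ) + 1) ^ 2 ≤ 1 / 2) :
    pertZ (multivariateGaussian 0 Γ) (fun X ω => f X (ω + ψ)) 𝒳 =
      ∏ Y ∈ rconnSubsets R (𝒳.biUnion id), (1 + (Complex.exp
        (∑ 𝒞 ∈ ((rconnSubsets (Touches R) 𝒳).image fun 𝒜 => 𝒜.biUnion id).powerset with 𝒞.biUnion id = Y,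
          truncatedWeight (GeomInc R) (pushforwardActivity (fun 𝒜 : Finset (Finset V) => 𝒜.biUnion id)
            (cellActivity (multivariateGaussian 0 Γ) fun X ω => f X (ω + ψ)) (rconnSubsets (Touches R) 𝒳)) 𝒞) - 1)) := by
  rw [← exp_sum_eq_prod_one_add]
  exact (step_exp_sum_support hΓ hΓop hdiag hγ hfr cell hdisj hv hRsymm hR hΔ hnbr hε hκ hτ hθ0 hθ1 hκθ 𝒳 hconn hmeas hreg hsup ψ hψ
    hsmall).symm

omit [Fintype ι] [DecidableEq ι] in
/-- **THE NEXT FACTORS ARE LOCAL IN THE FIELD** (no smallness): factors local in the field on their sets, two fields equal on the cells of `Y` ⟹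
`e^{K⁺_Y(ψ)} − 1 = e^{K⁺_Y(ψ')} − 1`. [folklore] -/
theorem road_step_nextFactor_local (μ : Measure (EuclideanSpace ℝ ι)) (cell : V → Finset ι) {f : Finset V → EuclideanSpace ℝ ι → ℂ}
    (𝒳 : Finset (Finset V))
    (hloc : ∀ X ∈ 𝒳, ∀ (ω ψ ψ' : EuclideanSpace ℝ ι), (∀ p ∈ X, ∀ x ∈ cell p, ψ x = ψ' x) → f X (ω + ψ) = f X (ω + ψ'))
    {ψ ψ' : EuclideanSpace ℝ ι} (Y : Finset V) (hagree : ∀ p ∈ Y, ∀ x ∈ cell p, ψ x = ψ' x) :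
    Complex.exp (∑ 𝒞 ∈ ((rconnSubsets (Touches R) 𝒳).image fun 𝒜 => 𝒜.biUnion id).powerset with 𝒞.biUnion id = Y,
        truncatedWeight (GeomInc R) (pushforwardActivity (fun 𝒜 : Finset (Finset V) => 𝒜.biUnion id)
          (cellActivity μ fun X ω => f X (ω + ψ)) (rconnSubsets (Touches R) 𝒳)) 𝒞) - 1 =
      Complex.exp (∑ 𝒞 ∈ ((rconnSubsets (Touches R) 𝒳).image fun 𝒜 => 𝒜.biUnion id).powerset with 𝒞.biUnion id = Y,
        truncatedWeight (GeomInc R) (pushforwardActivity (fun 𝒜 : Finset (Finset V) => 𝒜.biUnion id)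
          (cellActivity μ fun X ω => f X (ω + ψ')) (rconnSubsets (Touches R) 𝒳)) 𝒞) - 1 := by
  rw [step_supportTerm_local (R := R) μ cell 𝒳 hloc Y hagree]

/-- **THE NEXT FACTORS HAVE SMALL PINNED NORM**: under the activity-letter hypotheses of (355) (no measurability, no range), `0 ≤ τ₂`,
`(Δ+1)²ε′e^{1+τ₂} ≤ 1∕2` and `(Δ+1)·((Δ+1)·2ε′e^{1+τ₂}) ≤ 1` ⟹ for every cell `q`,
`Σ_{Y∈𝒫(⋃𝒳) touching {q}}‖e^{K⁺_Y(ψ)} − 1‖e^{τ₂#Y} ≤ 2(Δ+1)·((Δ+1)·2ε′e^{1+τ₂})`. [folklore] -/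
theorem road_step_nextFactors_norm_le {Γ : Matrix ι ι ℝ} {γop γ : ℝ} (hΓ : Γ.PosSemidef) (hΓop : (γop • (1 : Matrix ι ι ℝ) - Γ).PosSemidef)
    (hdiag : ∀ i, Γ i i ≤ γ) (hγ : 0 ≤ γ) (cell : V → Finset ι) (hdisj : ∀ p q, p ≠ q → Disjoint (cell p) (cell q)) {v : ℕ}
    (hv : ∀ p, (cell p).card ≤ v) (hRsymm : ∀ x y, R x y → R y x) (hΔ : ∀ x, (nbr x).card ≤ Δ) (hnbr : ∀ x y, R x y → y ∈ nbr x)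
    {f : Finset V → EuclideanSpace ℝ ι → ℂ} {ε κ τ θ Ψ : ℝ} (hε : 0 ≤ ε) (hκ : 0 ≤ κ) (hτ : 0 < τ)
    (hθ0 : 0 < θ) (hθ1 : θ < 1) (hκθ : κ * (1 + τ) * γop ≤ θ) (𝒳 : Finset (Finset V)) (hconn : ∀ X ∈ 𝒳, IsRConnected R X)
    (hreg : ∀ X ∈ 𝒳, X.card = 1 → ∀ ω : EuclideanSpace ℝ ι, ‖f X ω‖ ≤ ε ^ X.card * exp (κ * (∑ x ∈ X.biUnion cell, ω x ^ 2) / 2))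
    (hsup : ∀ X ∈ 𝒳, X.card ≠ 1 → ∀ ω : EuclideanSpace ℝ ι, ‖f X ω‖ ≤ ε ^ X.card) (ψ : EuclideanSpace ℝ ι)
    (hψ : ∀ X ∈ 𝒳, X.card = 1 → ∑ x ∈ X.biUnion cell, ψ x ^ 2 ≤ Ψ ^ 2) {τ₂ : ℝ} (hτ₂ : 0 ≤ τ₂)
    (hsmall : ((Δ : ℝ) + 1) ^ 2 * ((Real.sqrt ((ε * exp (κ * (1 + τ⁻¹) * Ψ ^ 2 / 2)) * ((1 - θ) ^ (-(κ * (1 + τ) * γ / (2 * θ)))) ^ v) *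
      Real.exp (2 * Real.sqrt ((ε * exp (κ * (1 + τ⁻¹) * Ψ ^ 2 / 2)) * ((1 - θ) ^ (-(κ * (1 + τ) * γ / (2 * θ)))) ^ v))) *
      Real.exp (1 + τ₂)) ≤ 1 / 2)
    (hη1 : ((Δ : ℝ) + 1) * (((Δ : ℝ) + 1) * (2 * ((Real.sqrt ((ε * exp (κ * (1 + τ⁻¹) * Ψ ^ 2 / 2)) *
      ((1 - θ) ^ (-(κ * (1 + τ) * γ / (2 * θ)))) ^ v) * Real.exp (2 * Real.sqrt ((ε * exp (κ * (1 + τ⁻¹) * Ψ ^ 2 / 2)) *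
      ((1 - θ) ^ (-(κ * (1 + τ) * γ / (2 * θ)))) ^ v))) * Real.exp (1 + τ₂)))) ≤ 1) (q : V) :
    ∑ Y ∈ rconnSubsets R (𝒳.biUnion id) with Touches R Y {q},
        ‖Complex.exp (∑ 𝒞 ∈ ((rconnSubsets (Touches R) 𝒳).image fun 𝒜 => 𝒜.biUnion id).powerset with 𝒞.biUnion id = Y,
          truncatedWeight (GeomInc R) (pushforwardActivity (fun 𝒜 : Finset (Finset V) => 𝒜.biUnion id)
            (cellActivity (multivariateGaussian 0 Γ) fun X ω => f X (ω + ψ)) (rconnSubsets (Touches R) 𝒳)) 𝒞) - 1‖ * Real.exp (τ₂ * (Y.card : ℝ)) ≤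
      2 * (((Δ : ℝ) + 1) * (((Δ : ℝ) + 1) * (2 * ((Real.sqrt ((ε * exp (κ * (1 + τ⁻¹) * Ψ ^ 2 / 2)) *
        ((1 - θ) ^ (-(κ * (1 + τ) * γ / (2 * θ)))) ^ v) * Real.exp (2 * Real.sqrt ((ε * exp (κ * (1 + τ⁻¹) * Ψ ^ 2 / 2)) *
        ((1 - θ) ^ (-(κ * (1 + τ) * γ / (2 * θ)))) ^ v))) * Real.exp (1 + τ₂))))) := by
  have hε' := SupPolymerLocalExpansion.eps'_nonneg ((ε * exp (κ * (1 + τ⁻¹) * Ψ ^ 2 / 2)) * ((1 - θ) ^ (-(κ * (1 + τ) * γ / (2 * θ)))) ^ v)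
  obtain ⟨-, hz⟩ := shifted_pushforward_letters hΓ hΓop hdiag hγ cell hdisj hv hRsymm hΔ hnbr hε hκ hτ hθ0 hθ1 hκθ 𝒳 hconn hreg hsup ψ hψ
    (smallness_e_of_decay hε' hτ₂ hsmall)
  exact nextFactors_touchNorm_le hRsymm hΔ hnbr 𝒳 hconn hε' hτ₂ hz hsmall hη1 q

/-! ## Toy -/

omit [DecidableEq V] [DecidableRel R] [Fintype ι] [DecidableEq ι] in
/-- Toy: a Mayer product over NO supports is `1`. -/
example (g : Finset V → ℂ) : ∏ Y ∈ (∅ : Finset (Finset V)), (1 + (Complex.exp (g Y) - 1)) = 1 := prod_empty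

end Summit.QuantumFields.BalabanUV.T4Continuum.NE7b.SupRoadStepMayerData
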